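import Mathlib
import Literature.RingTheory.PBasis.KunzConjectureDimTwo
import HarnessLib

/-!
# Harper's theorem on differentiably simple rings (Harper–Yuan), and Kunz's conjecture discharged

Topic: `Literature/RingTheory/PBasis`. This file PROVES (sorry-free, no named fact, no new definition)

* `HarperYuan.exists_presentation` / `HarperYuan.harper` — **Harper's theorem** (L. Harper, Trans. AMS 100
  (1961) 63–72, Thm. 1, there for algebras over an algebraically closed field; S. Yuan 1964 Cor. 2.8 in general;
  stated and re-proved as Theorem 2.4 «Harper–Yuan» of C. del Buey de Andrés, D. Sulca, O. Villamayor,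
  *Differentiably simple rings and ring extensions defined by p-basis*, JPAA 228 (2024) 107735 =
  arXiv:2211.09125, §2, held text `paper:arxiv-2211.09125` p. 4–5): a local ring `A` of characteristic `p`
  which is module-finite over a coefficient field `κ`, with `a^p = 0` on `𝔫`, and in which every nonzero proper
  ideal is moved by some `κ`-derivation, is `κ[X₁, …, Xₙ]/(X₁^p, …, Xₙ^p)` with `Xᵢ ↦ xᵢ` a minimal system
  of generators of `𝔫`; in particular `𝔫` is `n`-generated with `p^n = dim_κ A` — VERBATIM the hypothesis
  `hH` of the landed `RelativePBasis.kimuraNiitsuma1982_theorem_of_harper` (`KunzConjectureDimTwo.lean`);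
* `KimuraNiitsuma1982_theorem_holds : KimuraNiitsuma1982_theorem` — the DISCHARGE of the named fact F-96h
  (T. Kimura, H. Niitsuma, *On Kunz's conjecture*, J. Math. Soc. Japan 34 (1982) 371–378, THEOREM of §3,
  p. 375: a regular local ring of characteristic `p`, module-finite over a regular local subring `R' ⊇ R^p`,
  has a `p`-basis over `R'`), by the tree's reductions `kimuraNiitsuma1982_theorem_of_lemma5` (KN's induction,
  `KunzConjectureReduction.lean`) and `lemma5_of_harper` (their Lemma 5 through the Artinian core,
  `KunzConjectureDimTwo.lean`) fed with `HarperYuan.harper`.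

## The proof of Harper's theorem formalised here (dBSV 2022, proof of Thm. 2.4, one page)

Let `x₁, …, xₙ` be a minimal system of generators of `𝔫` — here: generators which are `κ`-linearly independent
modulo `𝔫²` (`exists_generators_indep`, by Nakayama from a generating family of minimal length) — and
`π : S = κ[X₁, …, Xₙ] → A`, `Xᵢ ↦ xᵢ`, which is onto because `κ` is a coefficient field and `𝔫` is nilpotent
(`aeval_surjective`, the tree's filtered lemma `top_le_sup_span_pow_sup_pow`), with kernel `I ⊇ (Xᵢ^p)`.
1. Minimality gives `I ⊆ (X)²` (`ker_le_sq`: the constant term of `f ∈ I` vanishes as `π(f) = 0 ∈ 𝔫`, and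
   its linear part `Σ cᵢXᵢ` maps to `Σ cᵢxᵢ ∈ 𝔫²`, so `c = 0`).
2. (dBSV Lemma 2.5 for the polynomial ring) every `κ`-derivation `δ` of `A` lifts to a `κ`-derivation `D` of
   `S` with `π ∘ D = δ ∘ π`: `D(Xᵢ) :=` a preimage of `δ(xᵢ)` (`exists_derivation_lift`,
   Mathlib `MvPolynomial.mkDerivation`).
3. (`derivation_mem_ker`) Let `J = I + (E(f) : f ∈ I, E ∈ Der_κ(S))`. By 1 and Leibniz, constant terms
   vanish on `J`, so `π(J) ⊆ 𝔫` is proper. For `δ ∈ Der_κ(A)` with lift `D`: `D(I) ⊆ I` and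
   `D(E f) = E(D f) − [E, D](f) ∈ J`, so `D(J) ⊆ J` and `π(J)` is `δ`-stable. By differential simplicity
   `π(J) = 0`, i.e. `E(I) ⊆ I` for every `κ`-derivation `E` of `S`, in particular for the `∂/∂Xᵢ`.
4. (`ker_aeval_eq_frobIdeal`, assertion (*) of dBSV Example 2.3) the image of `I` in `κ[X]/(Xᵢ^p)` is then a
   proper ideal stable under all `∂/∂Xᵢ`, hence zero by the tree's `TruncPoly.ideal_eq_top_of_forall_D_mem`
   (a common zero of commuting nilpotent operators in a stable ideal is a nonzero constant); so `I = (Xᵢ^p)`,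
   `A ≅ κ[X]/(Xᵢ^p)` and `dim_κ A = p^n` by the monomial basis `TruncPoly.monBasis`.
Yuan's Lemma 2.2 (a differentiably simple ring of characteristic `p` is local with `x^p = 0` on `𝔫` and has a
coefficient field) is not needed: these are hypotheses of `hH`. The derivations of `hH` are raw additive Leibniz
`κ`-killing maps `A → A`; `exists_derivation_of_leibniz` turns them into Mathlib `Derivation κ A A`.

Not a statement of H. Hironaka's manuscript; settled mathematics (1961/1964/1982). Resolution of singularities
in positive characteristic is not proved by any of this. Written by seat `res-B-lit-kn82` g2 (literature-prover)
of cell res-hironaka for the INPUTS desk (F-96h discharge, director orders DR-E10/DR-E10a).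

## References
* C. del Buey de Andrés, D. Sulca, O. E. Villamayor, *Differentiably simple rings and ring extensions defined by
  p-basis*, J. Pure Appl. Algebra 228 (2024) 107735; arXiv:2211.09125: Lemma 2.5, Theorem 2.4 and its proof,
  Example 2.3 (*). [delBueySulcaVillamayor2022]
* L. Harper, *On differentiably simple algebras*, Trans. Amer. Math. Soc. 100 (1961) 63–72, Thm. 1. [Harper1961]
* T. Kimura, H. Niitsuma, *On Kunz's conjecture*, J. Math. Soc. Japan 34 (1982) 371–378, Theorem §3 p. 375,
  finite case p. 375–376. [KimuraNiitsuma1982]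
* H. Matsumura, *Commutative Ring Theory*, CUP 1986, §26 closing Remark (Harper's theorem and Kunz's
  conjecture, p. 224). [Matsumura1987]
-/

namespace Literature.RingTheory.PBasis

universe u v

namespace HarperYuan

open IsLocalRing _root_.MvPolynomial

/-! ### Step 1: a minimal system of generators of the maximal ideal -/

section Generators

variable {A : Type u} [CommRing A] [IsLocalRing A] {κ : Type v} [Field κ] [Algebra κ A]

/-- **Minimal bases of the maximal ideal** (Matsumura, Thm. 2.3 (ii): «every minimal basis of `M` is obtained in
this way», i.e. its images are linearly independent in `M/𝔪M`): a finitely generated maximal ideal of a local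
`κ`-algebra has a system of generators `x₁, …, xₙ` (one of minimal length) which is linearly independent modulo
`𝔫²` for coefficients from `κ` (Nakayama). [cite: Matsumura1987, Theorem 2.3 (ii) p. 8] -/
theorem exists_generators_indep [IsNoetherianRing A] :
    ∃ (n : ℕ) (x : Fin n → A), Ideal.span (Set.range x) = maximalIdeal A ∧
      ∀ c : Fin n → κ, (∑ i, c i • x i) ∈ (maximalIdeal A) ^ 2 → c = 0 := by
  classical
  have hfg : (maximalIdeal A).FG := IsNoetherian.noetherian _
  have hex : ∃ n, ∃ x : Fin n → A, Ideal.span (Set.range x) = maximalIdeal A := by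
    obtain ⟨n, s, hs⟩ := Submodule.fg_iff_exists_fin_generating_family.mp hfg
    exact ⟨n, s, hs⟩
  let n := Nat.find hex
  obtain ⟨x, hx⟩ : ∃ x : Fin n → A, Ideal.span (Set.range x) = maximalIdeal A := Nat.find_spec hex
  have hmin : ∀ m < n, ¬ ∃ x : Fin m → A, Ideal.span (Set.range x) = maximalIdeal A :=
    fun m hm => Nat.find_min hex hm
  refine ⟨n, x, hx, fun c hc => ?_⟩
  by_contra hne
  obtain ⟨j, hj⟩ : ∃ j, c j ≠ 0 := Function.ne_iff.mp hne
  -- `n = m + 1`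
  obtain ⟨m, hm⟩ : ∃ m, n = m + 1 := ⟨n - 1, (Nat.succ_pred_eq_of_pos (Fin.pos j)).symm⟩
  -- the generators other than `x j`
  let e : Fin (m + 1) ≃ Fin n := finCongr hm.symm
  let j' : Fin (m + 1) := e.symm j
  let x' : Fin m → A := fun k => x (e (j'.succAbove k))
  let N : Ideal A := Ideal.span (Set.range x')
  have hNle : N ≤ maximalIdeal A := by
    rw [← hx]
    apply Ideal.span_mono
    rintro _ ⟨k, rfl⟩
    exact ⟨_, rfl⟩
  -- `x j ∈ N + 𝔫²`
  have hsum : (∑ i, c i • x i) = c j • x j + ∑ k, c (e (j'.succAbove k)) • x' k := by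
    have : (∑ i, c i • x i) = ∑ i : Fin (m + 1), c (e i) • x (e i) := by
      rw [← Equiv.sum_comp e (fun i => c i • x i)]
    rw [this, Fin.sum_univ_succAbove _ j']
    simp only [x', j', Equiv.apply_symm_apply]
  have hxj : x j ∈ N ⊔ maximalIdeal A • maximalIdeal A := by
    have h1 : c j • x j = (∑ i, c i • x i) - ∑ k, c (e (j'.succAbove k)) • x' k := by
      rw [hsum, add_sub_cancel_right]
    have h2 : c j • x j ∈ N ⊔ maximalIdeal A • maximalIdeal A := by
      rw [h1]
      refine Ideal.sub_mem _ ?_ ?_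
      · apply Ideal.mem_sup_right
        rw [Ideal.smul_eq_mul, ← pow_two]
        exact hc
      · apply Ideal.mem_sup_left
        refine Ideal.sum_mem _ fun k _ => ?_
        rw [Algebra.smul_def]
        exact Ideal.mul_mem_left _ _ (Ideal.subset_span ⟨k, rfl⟩)
    have h3 : x j = (c j)⁻¹ • (c j • x j) := by
      rw [smul_smul, inv_mul_cancel₀ hj, one_smul]
    rw [h3]
    exact Submodule.smul_of_tower_mem _ _ h2
  have hle : maximalIdeal A ≤ N ⊔ maximalIdeal A • maximalIdeal A := by
    conv_lhs => rw [← hx]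
    rw [Ideal.span_le]
    rintro _ ⟨i, rfl⟩
    by_cases hij : i = j
    · rw [hij]
      exact hxj
    · -- `i = e (j'.succAbove k)` for some `k`
      have hij' : e.symm i ≠ j' := fun h => hij (e.symm.injective h)
      obtain ⟨k, hk⟩ := Fin.exists_succAbove_eq hij'
      apply Ideal.mem_sup_left
      refine Ideal.subset_span ⟨k, ?_⟩
      simp only [x', hk, Equiv.apply_symm_apply]
  have hN : maximalIdeal A ≤ N :=
    Submodule.le_of_le_smul_of_le_jacobson_bot hfg (IsLocalRing.maximalIdeal_le_jacobson _) hle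
  have hNeq : N = maximalIdeal A := le_antisymm hNle hN
  exact hmin m (by omega) ⟨x', hNeq⟩

end Generators

/-! ### Step 2: the presentation `π : κ[X₁, …, Xₙ] → A`, `Xᵢ ↦ xᵢ` -/

section Presentation

variable {A : Type u} [CommRing A] [IsLocalRing A] {κ : Type v} [Field κ] [Algebra κ A] {n : ℕ}
  (x : Fin n → A)

/-- If all `xᵢ ∈ 𝔫` then `g(x) ≡ g(0) (mod 𝔫)` for every polynomial `g`. [folklore] -/
private theorem aeval_sub_algebraMap_constantCoeff_mem (hx : ∀ i, x i ∈ maximalIdeal A)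
    (g : MvPolynomial (Fin n) κ) :
    aeval x g - algebraMap κ A (constantCoeff g) ∈ maximalIdeal A := by
  induction g using MvPolynomial.induction_on with
  | C c =>
    rw [aeval_C, constantCoeff_C, sub_self]
    exact zero_mem _
  | add f g hf hg =>
    rw [map_add, map_add, map_add, add_sub_add_comm]
    exact add_mem hf hg
  | mul_X f i _ =>
    rw [map_mul, aeval_X, map_mul, constantCoeff_X, mul_zero, map_zero, sub_zero]
    exact Ideal.mul_mem_left _ _ (hx i)

/-- If all `xᵢ ∈ 𝔫` then `g(x) ∈ 𝔫 ↔ g(0) = 0`. [folklore] -/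
private theorem aeval_mem_maximalIdeal_iff (hx : ∀ i, x i ∈ maximalIdeal A) (g : MvPolynomial (Fin n) κ) :
    aeval x g ∈ maximalIdeal A ↔ constantCoeff g = 0 := by
  have h := aeval_sub_algebraMap_constantCoeff_mem x hx g
  constructor
  · intro hg
    by_contra hc
    have hu : IsUnit (algebraMap κ A (constantCoeff g)) := (IsUnit.mk0 _ hc).map _
    have hmem : algebraMap κ A (constantCoeff g) ∈ maximalIdeal A := by
      have := sub_mem hg h
      rwa [sub_sub_cancel] at this
    exact (maximalIdeal.isMaximal A).ne_top (Ideal.eq_top_of_isUnit_mem _ hmem hu)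
  · intro hc
    rw [hc, map_zero, sub_zero] at h
    exact h

/-- In a local ring which is module-finite over a field, the maximal ideal is nilpotent. [folklore] -/
private theorem exists_maximalIdeal_pow_eq_bot [Module.Finite κ A] : ∃ N : ℕ, maximalIdeal A ^ N = ⊥ := by
  haveI : IsArtinianRing A := IsArtinianRing.of_finite κ A
  obtain ⟨N, hN⟩ := IsArtinianRing.isNilpotent_jacobson_bot (R := A)
  rw [IsLocalRing.jacobson_eq_maximalIdeal ⊥ bot_ne_top] at hN
  exact ⟨N, hN⟩

/-- **Residual rationality makes the presentation onto** («By Lemma 2.2, this map is surjective», dBSV proof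
of Thm. 2.4): if `κ` is a coefficient field of the local ring `A` (every element is congruent to a scalar modulo
`𝔫`), `𝔫` is nilpotent and `𝔫 = (x₁, …, xₙ)`, then `κ[X₁, …, Xₙ] → A`, `Xᵢ ↦ xᵢ`, is surjective.
[cite: delBueySulcaVillamayor2022, proof of Theorem 2.4 p. 4] -/
theorem aeval_surjective (hcoef : ∀ a : A, ∃ c : κ, a - algebraMap κ A c ∈ maximalIdeal A)
    (hnil : ∃ N : ℕ, maximalIdeal A ^ N = ⊥) (hx : Ideal.span (Set.range x) = maximalIdeal A) :
    Function.Surjective (aeval x : MvPolynomial (Fin n) κ →ₐ[κ] A) := by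
  obtain ⟨N, hN⟩ := hnil
  have hsubmod : (⊤ : Submodule κ A) ≤ (Algebra.adjoin κ (Set.range x)).toSubmodule := by
    have htop := Literature.AlgebraicGeometry.Resolution.top_le_sup_span_pow_sup_pow (R := κ)
      (maximalIdeal A) (Set.range x) hx.symm hcoef N
    have hbot : (maximalIdeal A) ^ (N + 1) = ⊥ := by
      rw [eq_bot_iff, ← hN]
      exact Ideal.pow_le_pow_right (Nat.le_succ N)
    rw [hbot, Submodule.restrictScalars_bot, sup_bot_eq] at htop
    have hpow : ∀ j : ℕ, Submodule.span κ (Set.range x) ^ j ≤ (Algebra.adjoin κ (Set.range x)).toSubmodule := by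
      intro j
      induction j with
      | zero =>
        rw [pow_zero, Submodule.one_le]
        exact Subalgebra.one_mem _
      | succ j ih =>
        rw [pow_succ, Submodule.mul_le]
        intro a ha b hb
        have hb' : b ∈ (Algebra.adjoin κ (Set.range x)).toSubmodule :=
          (Submodule.span_le.mpr (Algebra.subset_adjoin (R := κ) (s := Set.range x))) hb
        exact Subalgebra.mul_mem _ (ih ha) hb'
    exact htop.trans (Finset.sup_le fun j _ => hpow j)
  have hadj : Algebra.adjoin κ (Set.range x) = ⊤ := by
    rw [eq_top_iff]
    intro v _
    exact hsubmod Submodule.mem_top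
  rw [← AlgHom.range_eq_top, ← Algebra.adjoin_range_eq_range_aeval, hadj]

omit [IsLocalRing A] in
/-- **Lifting derivations along the presentation** (dBSV 2022 Lemma 2.5 for `S = κ[X₁, …, Xₙ]`): every
`κ`-derivation `δ` of `A` lifts to a `κ`-derivation `D` of `κ[X]` with `π ∘ D = δ ∘ π` — put `D(Xᵢ) :=` any
preimage of `δ(xᵢ)`. [cite: delBueySulcaVillamayor2022, Lemma 2.5] -/
theorem exists_derivation_lift (hsurj : Function.Surjective (aeval x : MvPolynomial (Fin n) κ →ₐ[κ] A))
    (δ : Derivation κ A A) :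
    ∃ D : Derivation κ (MvPolynomial (Fin n) κ) (MvPolynomial (Fin n) κ),
      ∀ f, aeval x (D f) = δ (aeval x f) := by
  choose g hg using fun i => hsurj (δ (x i))
  refine ⟨mkDerivation κ g, fun f => ?_⟩
  induction f using MvPolynomial.induction_on with
  | C c =>
    rw [← MvPolynomial.algebraMap_eq, Derivation.map_algebraMap, AlgHom.commutes, Derivation.map_algebraMap,
      map_zero]
  | add f₁ f₂ h₁ h₂ =>
    rw [map_add, map_add, map_add, map_add, h₁, h₂]
  | mul_X f₁ i h₁ =>
    rw [Derivation.leibniz, mkDerivation_X, smul_eq_mul, smul_eq_mul, map_add, map_mul, map_mul,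
      aeval_X, hg, h₁, map_mul, aeval_X, Derivation.leibniz, smul_eq_mul, smul_eq_mul]

end Presentation

/-! ### Step 3: polynomials without constant and linear terms, `(X₁, …, Xₙ)²` -/

section Quadratic

variable {κ : Type v} [Field κ] {n : ℕ}

/-- Elements of `(X₁, …, Xₙ)²` have zero constant term, and so do their images under any `κ`-derivation of
`κ[X]` (Leibniz). [folklore] -/
private theorem constantCoeff_eq_zero_of_mem_sq
    (E : Derivation κ (MvPolynomial (Fin n) κ) (MvPolynomial (Fin n) κ)) {g : MvPolynomial (Fin n) κ}
    (hg : g ∈ (Ideal.span (Set.range (X : Fin n → MvPolynomial (Fin n) κ))) ^ 2) :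
    constantCoeff g = 0 ∧ constantCoeff (E g) = 0 := by
  rw [pow_two, Ideal.span_mul_span'] at hg
  induction hg using Submodule.span_induction with
  | mem g hg =>
    obtain ⟨_, ⟨i, rfl⟩, _, ⟨j, rfl⟩, rfl⟩ := Set.mem_mul.mp hg
    refine ⟨by rw [map_mul, constantCoeff_X, zero_mul], ?_⟩
    rw [Derivation.leibniz, smul_eq_mul, smul_eq_mul, map_add, map_mul, map_mul, constantCoeff_X,
      constantCoeff_X, zero_mul, zero_mul, add_zero]
  | zero => exact ⟨map_zero _, by rw [map_zero, map_zero]⟩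
  | add g₁ g₂ _ _ h₁ h₂ =>
    exact ⟨by rw [map_add, h₁.1, h₂.1, add_zero], by rw [map_add, map_add, h₁.2, h₂.2, add_zero]⟩
  | smul a g _ h =>
    refine ⟨by rw [smul_eq_mul, map_mul, h.1, mul_zero], ?_⟩
    rw [smul_eq_mul, Derivation.leibniz, smul_eq_mul, smul_eq_mul, map_add, map_mul, map_mul, h.1, h.2,
      mul_zero, zero_mul, add_zero]

/-- An exponent vector which is neither `0` nor a unit vector dominates a sum of two unit vectors. [folklore] -/
private theorem exists_single_add_single_le {m : Fin n →₀ ℕ} (h0 : m ≠ 0) (h1 : ∀ i, m ≠ Finsupp.single i 1) :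
    ∃ i j : Fin n, Finsupp.single i 1 + Finsupp.single j 1 ≤ m := by
  obtain ⟨i, hi⟩ : ∃ i, m i ≠ 0 := by
    by_contra h
    exact h0 (Finsupp.ext fun i => by simpa using (not_exists.mp h) i)
  by_cases h2 : 2 ≤ m i
  · refine ⟨i, i, Finsupp.le_def.mpr fun k => ?_⟩
    simp only [Finsupp.coe_add, Pi.add_apply, Finsupp.single_apply]
    split_ifs with hik
    · subst hik; omega
    · omega
  · have hmi : m i = 1 := by omega
    obtain ⟨j, hj⟩ : ∃ j, m j ≠ Finsupp.single i 1 j := by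
      by_contra h
      exact h1 i (Finsupp.ext fun k => by simpa using (not_exists.mp h) k)
    have hji : j ≠ i := by
      rintro rfl
      rw [Finsupp.single_eq_same] at hj
      exact hj hmi
    rw [Finsupp.single_eq_of_ne hji] at hj
    refine ⟨i, j, Finsupp.le_def.mpr fun k => ?_⟩
    simp only [Finsupp.coe_add, Pi.add_apply, Finsupp.single_apply]
    split_ifs with hik hjk hjk
    · exact absurd (hjk.trans hik.symm) hji
    · subst hik; omega
    · subst hjk; omega
    · omega

/-- A polynomial all of whose monomials have degree `≥ 2` lies in `(X₁, …, Xₙ)²`. [folklore] -/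
private theorem mem_sq_of_support {f : MvPolynomial (Fin n) κ}
    (hf : ∀ m ∈ f.support, ∃ i j : Fin n, Finsupp.single i 1 + Finsupp.single j 1 ≤ m) :
    f ∈ (Ideal.span (Set.range (X : Fin n → MvPolynomial (Fin n) κ))) ^ 2 := by
  have hmem : f ∈ Ideal.span ((fun s => monomial s (1 : κ)) ''
      Set.range (fun ij : Fin n × Fin n => Finsupp.single ij.1 1 + Finsupp.single ij.2 1)) := by
    rw [mem_ideal_span_monomial_image]
    intro m hm
    obtain ⟨i, j, hij⟩ := hf m hm
    exact ⟨_, ⟨(i, j), rfl⟩, hij⟩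
  refine (Ideal.span_le.mpr ?_) hmem
  rintro _ ⟨_, ⟨⟨i, j⟩, rfl⟩, rfl⟩
  change monomial (Finsupp.single i 1 + Finsupp.single j 1) (1 : κ) ∈ Ideal.span (Set.range X) ^ 2
  rw [show monomial (Finsupp.single i 1 + Finsupp.single j 1) (1 : κ) =
      (X i : MvPolynomial (Fin n) κ) * X j by rw [X, X, monomial_mul, mul_one], pow_two]
  exact Ideal.mul_mem_mul (Ideal.subset_span ⟨i, rfl⟩) (Ideal.subset_span ⟨j, rfl⟩)

/-- **Taylor expansion to first order**: `f − f(0) − Σᵢ (∂f/∂Xᵢ)(0)·Xᵢ ∈ (X₁, …, Xₙ)²`. [folklore] -/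
private theorem sub_linearPart_mem_sq (f : MvPolynomial (Fin n) κ) :
    f - C (coeff 0 f) - ∑ i, C (coeff (Finsupp.single i 1) f) * X i ∈
      (Ideal.span (Set.range (X : Fin n → MvPolynomial (Fin n) κ))) ^ 2 := by
  classical
  apply mem_sq_of_support
  intro m hm
  rw [mem_support_iff, coeff_sub, coeff_sub, coeff_C, coeff_sum] at hm
  simp_rw [coeff_C_mul, coeff_X] at hm
  apply exists_single_add_single_le
  · rintro rfl
    apply hm
    rw [if_pos rfl, sub_self, zero_sub, neg_eq_zero]
    refine Finset.sum_eq_zero fun i _ => ?_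
    rw [if_neg (Finsupp.single_ne_zero.mpr one_ne_zero), mul_zero]
  · rintro i rfl
    apply hm
    rw [if_neg (Finsupp.single_ne_zero.mpr one_ne_zero).symm, sub_zero,
      Finset.sum_eq_single i (fun j _ hji => by
        rw [if_neg (fun h => hji (Finsupp.single_left_injective one_ne_zero h)), mul_zero])
        (fun h => absurd (Finset.mem_univ i) h), if_pos rfl, mul_one, sub_self]

end Quadratic

/-! ### Step 4: the kernel of the presentation is stable under all derivations (dBSV 2022, proof of Thm 2.4) -/

section Core

variable {A : Type u} [CommRing A] [IsLocalRing A] {κ : Type v} [Field κ] [Algebra κ A] {n : ℕ}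
  (x : Fin n → A)

/-- For a MINIMAL system of generators `x` of `𝔫` (independent modulo `𝔫²`), the kernel of `Xᵢ ↦ xᵢ` lies in
`(X₁, …, Xₙ)²` («the assumption that `{x₁, …, xₙ}` is a minimal generating set for the maximal ideal translates to
the inclusion `I ⊂ ⟨X₁, …, Xₙ⟩²`»). [cite: delBueySulcaVillamayor2022, proof of Theorem 2.4] -/
theorem ker_le_sq (hxm : ∀ i, x i ∈ maximalIdeal A)
    (hind : ∀ c : Fin n → κ, (∑ i, c i • x i) ∈ (maximalIdeal A) ^ 2 → c = 0) :
    RingHom.ker (aeval x : MvPolynomial (Fin n) κ →ₐ[κ] A) ≤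
      (Ideal.span (Set.range (X : Fin n → MvPolynomial (Fin n) κ))) ^ 2 := by
  intro f hf
  rw [RingHom.mem_ker] at hf
  have hc0 : coeff 0 f = 0 := (aeval_mem_maximalIdeal_iff x hxm f).mp (by rw [hf]; exact zero_mem _)
  set g := f - C (coeff 0 f) - ∑ i, C (coeff (Finsupp.single i 1) f) * X i with hg
  have hgQ := sub_linearPart_mem_sq f
  rw [← hg] at hgQ
  -- `π((X)²) ⊆ 𝔫²`
  have hmapX : Ideal.map (aeval x : MvPolynomial (Fin n) κ →ₐ[κ] A)
      (Ideal.span (Set.range (X : Fin n → MvPolynomial (Fin n) κ))) ≤ maximalIdeal A := by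
    rw [Ideal.map_span, Ideal.span_le]
    rintro _ ⟨_, ⟨i, rfl⟩, rfl⟩
    rw [SetLike.mem_coe, aeval_X]
    exact hxm i
  have hgA : aeval x g ∈ (maximalIdeal A) ^ 2 := by
    have h := Ideal.mem_map_of_mem (aeval x : MvPolynomial (Fin n) κ →ₐ[κ] A) hgQ
    rw [Ideal.map_pow] at h
    exact Ideal.pow_right_mono hmapX 2 h
  -- the linear part of `f` vanishes at `x` modulo `𝔫²`, hence is zero
  have hlin : (∑ i, coeff (Finsupp.single i 1) f • x i) = -aeval x g := by
    rw [hg, map_sub, map_sub, hf, hc0, map_zero, map_zero, sub_zero, zero_sub, neg_neg, map_sum]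
    refine Finset.sum_congr rfl fun i _ => ?_
    rw [map_mul, aeval_C, aeval_X, Algebra.smul_def]
  have hcoef : (fun i => coeff (Finsupp.single i 1) f) = 0 :=
    hind _ (by rw [hlin]; exact neg_mem hgA)
  have hfg : f = g := by
    rw [hg, hc0, map_zero, sub_zero]
    refine (sub_eq_self.mpr (Finset.sum_eq_zero fun i _ => ?_)).symm
    rw [show coeff (Finsupp.single i 1) f = 0 from congr_fun hcoef i, map_zero, zero_mul]
  rw [hfg]
  exact hgQ

/-- **The kernel of the presentation of a differentiably simple ring is a differential ideal** (the heart of the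
dBSV proof of the Harper–Yuan theorem): let `A` be local with coefficient field `κ`, `𝔫 = (x₁, …, xₙ)` minimally,
`π : κ[X] → A` onto, and suppose every nonzero proper ideal of `A` is moved by some `κ`-derivation of `A`. With
`I = ker π` and `J = I + (E(f) : f ∈ I, E ∈ Der_κ κ[X])`: `J ⊆ (X)` so `π(J)` is proper; every `δ ∈ Der_κ(A)` lifts
to `D` with `π D = δ π`, `D(I) ⊆ I`, and `D(E f) = E(D f) − [E, D](f) ∈ J`, so `π(J)` is `δ`-stable; hence
`π(J) = 0`, i.e. `E(I) ⊆ I` for every derivation `E` of `κ[X]`.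
[cite: delBueySulcaVillamayor2022, proof of Theorem 2.4] -/
theorem derivation_mem_ker (hxm : ∀ i, x i ∈ maximalIdeal A)
    (hsurj : Function.Surjective (aeval x : MvPolynomial (Fin n) κ →ₐ[κ] A))
    (hind : ∀ c : Fin n → κ, (∑ i, c i • x i) ∈ (maximalIdeal A) ^ 2 → c = 0)
    (hds : ∀ I : Ideal A, I ≠ ⊥ → I ≠ ⊤ → ∃ δ : Derivation κ A A, ∃ b ∈ I, δ b ∉ I)
    (E : Derivation κ (MvPolynomial (Fin n) κ) (MvPolynomial (Fin n) κ))
    {f : MvPolynomial (Fin n) κ} (hf : f ∈ RingHom.ker (aeval x : MvPolynomial (Fin n) κ →ₐ[κ] A)) :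
    E f ∈ RingHom.ker (aeval x : MvPolynomial (Fin n) κ →ₐ[κ] A) := by
  set π : MvPolynomial (Fin n) κ →ₐ[κ] A := aeval x with hπ
  set I : Ideal (MvPolynomial (Fin n) κ) := RingHom.ker π with hI
  have hIQ : I ≤ (Ideal.span (Set.range (X : Fin n → MvPolynomial (Fin n) κ))) ^ 2 := ker_le_sq x hxm hind
  let G : Set (MvPolynomial (Fin n) κ) :=
    {g | ∃ f ∈ I, ∃ E : Derivation κ (MvPolynomial (Fin n) κ) (MvPolynomial (Fin n) κ), g = E f}
  let J : Ideal (MvPolynomial (Fin n) κ) := I ⊔ Ideal.span G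
  have hGJ : ∀ g ∈ G, g ∈ J := fun g hg => Ideal.mem_sup_right (Ideal.subset_span hg)
  -- (J1) `J ⊆ (X)`: constant terms vanish on `J`
  have hJcc : ∀ g ∈ J, constantCoeff g = 0 := by
    have hle : J ≤ RingHom.ker (constantCoeff : MvPolynomial (Fin n) κ →+* κ) := by
      refine sup_le (fun f hf => ?_) (Ideal.span_le.mpr ?_)
      · exact (constantCoeff_eq_zero_of_mem_sq 0 (hIQ hf)).1
      · rintro _ ⟨f, hf, E, rfl⟩
        exact (constantCoeff_eq_zero_of_mem_sq E (hIQ hf)).2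
    exact fun g hg => hle hg
  -- (J2) `π(J)` is a proper ideal
  have hJA : Ideal.map π J ≠ ⊤ := by
    intro htop
    have hle : Ideal.map π J ≤ maximalIdeal A := by
      rw [Ideal.map_le_iff_le_comap]
      intro g hg
      rw [Ideal.mem_comap]
      exact (aeval_mem_maximalIdeal_iff x hxm g).mpr (hJcc g hg)
    exact (maximalIdeal.isMaximal A).ne_top (top_le_iff.mp (htop ▸ hle))
  -- (J3) `π(J)` is stable under every `κ`-derivation of `A`
  have hJstab : ∀ δ : Derivation κ A A, ∀ v ∈ Ideal.map π J, δ v ∈ Ideal.map π J := by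
    intro δ v hv
    obtain ⟨D, hD⟩ := exists_derivation_lift x hsurj δ
    have hDI : ∀ f ∈ I, D f ∈ I := by
      intro f hf
      rw [hI, RingHom.mem_ker] at hf ⊢
      rw [hπ, hD, ← hπ, hf, map_zero]
    have hDG : ∀ g ∈ G, D g ∈ J := by
      rintro _ ⟨f, hf, E, rfl⟩
      have hcomm : D (E f) = E (D f) - ⁅E, D⁆ f := by
        rw [Derivation.commutator_apply, sub_sub_cancel]
      rw [hcomm]
      exact sub_mem (hGJ _ ⟨D f, hDI f hf, E, rfl⟩) (hGJ _ ⟨f, hf, ⁅E, D⁆, rfl⟩)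
    have hDJ : ∀ u ∈ J, D u ∈ J := by
      intro u hu
      obtain ⟨a, ha, b, hb, rfl⟩ := Submodule.mem_sup.mp hu
      rw [map_add]
      refine add_mem (Ideal.mem_sup_left (hDI a ha)) ?_
      clear hu
      induction hb using Submodule.span_induction with
      | mem g hg => exact hDG g hg
      | zero => rw [map_zero]; exact zero_mem _
      | add g₁ g₂ _ _ h₁ h₂ => rw [map_add]; exact add_mem h₁ h₂
      | smul s g hg h =>
        rw [smul_eq_mul, Derivation.leibniz, smul_eq_mul, smul_eq_mul]
        exact add_mem (Ideal.mul_mem_left _ _ h)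
          (Ideal.mul_mem_right _ _ (Ideal.mem_sup_right (show g ∈ Ideal.span G from hg)))
    obtain ⟨u, hu, rfl⟩ := (Ideal.mem_map_iff_of_surjective π hsurj).mp hv
    rw [hπ, ← hD]
    exact Ideal.mem_map_of_mem _ (hDJ u hu)
  -- (J4) differential simplicity: `π(J) = 0`
  have hJbot : Ideal.map π J = ⊥ := by
    by_contra hne
    obtain ⟨δ, b, hb, hδb⟩ := hds _ hne hJA
    exact hδb (hJstab δ b hb)
  -- (J5) conclusion
  have hEf : E f ∈ J := hGJ _ ⟨f, hf, E, rfl⟩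
  have h := Ideal.mem_map_of_mem π hEf
  rw [hJbot, Ideal.mem_bot] at h
  rw [RingHom.mem_ker]
  exact h

end Core

/-! ### Step 5: the kernel is `(X₁^p, …, Xₙ^p)` — assertion (*) via `TruncPoly.ideal_eq_top_of_forall_D_mem` -/

section DMk

variable {κ : Type v} [Field κ] {n : ℕ} {p : ℕ} [CharP κ p]

/-- `∂/∂Xᵢ` on `κ[X]/(Xᵢ^p)` on representatives (the defining property of `TruncPoly.D`). [folklore] -/
private theorem truncPoly_D_mk (i : Fin n) (f : MvPolynomial (Fin n) κ) :
    TruncPoly.D κ p n i (Ideal.Quotient.mk _ f) = Ideal.Quotient.mk _ (pderiv i f) := by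
  rw [← Ideal.Quotient.mk_eq_mk, ← Ideal.Quotient.mk_eq_mk]
  simp only [TruncPoly.D, LinearMap.coe_comp, LinearEquiv.coe_coe, Function.comp_apply,
    Submodule.Quotient.restrictScalarsEquiv_symm_mk, Submodule.mapQ_apply,
    Submodule.Quotient.restrictScalarsEquiv_mk]
  rfl

end DMk

section Kernel

variable {A : Type u} [CommRing A] [IsLocalRing A] {κ : Type v} [Field κ] [Algebra κ A] {n : ℕ}
  (x : Fin n → A) {p : ℕ} [hp : Fact p.Prime] [CharP κ p]

/-- **Harper–Yuan, kernel form** (dBSV 2022 Thm 2.4): let `A` be a local ring of characteristic `p` with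
coefficient field `κ`, `a^p = 0` on `𝔫`, `𝔫 = (x₁, …, xₙ)` a minimal system of generators (independent modulo
`𝔫²`), `π : κ[X₁, …, Xₙ] → A`, `Xᵢ ↦ xᵢ` onto, and suppose every nonzero proper ideal of `A` is moved by a
`κ`-derivation of `A`. Then `ker π = (X₁^p, …, Xₙ^p)`, i.e. `π` induces `κ[X₁, …, Xₙ]/(Xᵢ^p) ≅ A`. Proof: `ker π ⊇ (Xᵢ^p)`
as `xᵢ^p = 0`; `ker π` is stable under all `∂/∂Xᵢ` (`derivation_mem_ker`) and consists of polynomials without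
constant term, so its image in `κ[X]/(Xᵢ^p)` is a proper ideal stable under all `∂/∂Xᵢ`, hence zero by the
differential simplicity of the truncated polynomial ring (assertion (*) of dBSV Example 2.3 = the tree's
`TruncPoly.ideal_eq_top_of_forall_D_mem`). [cite: delBueySulcaVillamayor2022, Theorem 2.4] -/
theorem ker_aeval_eq_frobIdeal (hxm : ∀ i, x i ∈ maximalIdeal A) (hxp : ∀ i, x i ^ p = 0)
    (hsurj : Function.Surjective (aeval x : MvPolynomial (Fin n) κ →ₐ[κ] A))
    (hind : ∀ c : Fin n → κ, (∑ i, c i • x i) ∈ (maximalIdeal A) ^ 2 → c = 0)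
    (hds : ∀ I : Ideal A, I ≠ ⊥ → I ≠ ⊤ → ∃ δ : Derivation κ A A, ∃ b ∈ I, δ b ∉ I) :
    RingHom.ker (aeval x : MvPolynomial (Fin n) κ →ₐ[κ] A) = TruncPoly.frobIdeal κ p n := by
  set π : MvPolynomial (Fin n) κ →ₐ[κ] A := aeval x with hπ
  set I : Ideal (MvPolynomial (Fin n) κ) := RingHom.ker π with hI
  -- `(Xᵢ^p) ⊆ ker π`
  have hle : TruncPoly.frobIdeal κ p n ≤ I := by
    rw [TruncPoly.frobIdeal, Ideal.span_le]
    rintro _ ⟨i, rfl⟩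
    rw [SetLike.mem_coe, hI, RingHom.mem_ker, map_pow, hπ, aeval_X, hxp]
  refine le_antisymm ?_ hle
  -- the image `J'` of `ker π` in `κ[X]/(Xᵢ^p)` is a proper ideal stable under all `∂/∂Xᵢ`
  let J' : Ideal (TruncPoly.Alg κ p n) := I.map (Ideal.Quotient.mk (TruncPoly.frobIdeal κ p n))
  have hJ'top : J' ≠ ⊤ := by
    intro htop
    have h1 : (1 : TruncPoly.Alg κ p n) ∈ J' := htop ▸ Submodule.mem_top
    obtain ⟨f, hf, hf1⟩ := (Ideal.mem_map_iff_of_surjective _ Ideal.Quotient.mk_surjective).mp h1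
    have hf1' : f - 1 ∈ I := by
      apply hle
      rw [← Ideal.Quotient.eq_zero_iff_mem, map_sub, hf1, map_one, sub_self]
    have h1I : (1 : MvPolynomial (Fin n) κ) ∈ I := by simpa using sub_mem hf hf1'
    rw [hI, RingHom.mem_ker, map_one] at h1I
    exact one_ne_zero h1I
  have hJ'stab : ∀ i, ∀ u ∈ J', TruncPoly.D κ p n i u ∈ J' := by
    intro i u hu
    obtain ⟨f, hf, rfl⟩ := (Ideal.mem_map_iff_of_surjective _ Ideal.Quotient.mk_surjective).mp hu
    rw [truncPoly_D_mk]
    exact Ideal.mem_map_of_mem _ (derivation_mem_ker x hxm hsurj hind hds (pderiv i) hf)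
  -- hence `J' = 0`, i.e. `ker π ⊆ (Xᵢ^p)`
  have hJ'bot : J' = ⊥ := by
    by_contra hne
    exact hJ'top (TruncPoly.ideal_eq_top_of_forall_D_mem J' hne hJ'stab)
  intro f hf
  have h := Ideal.mem_map_of_mem (Ideal.Quotient.mk (TruncPoly.frobIdeal κ p n)) hf
  change Ideal.Quotient.mk (TruncPoly.frobIdeal κ p n) f ∈ J' at h
  rw [hJ'bot, Ideal.mem_bot, Ideal.Quotient.eq_zero_iff_mem] at h
  exact h

end Kernel

/-! ### Step 6: Harper's theorem -/

section Harper

variable (p : ℕ) [hp : Fact p.Prime] (A : Type u) [CommRing A] [IsLocalRing A] [CharP A p]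
  (κ : Type v) [Field κ] [Algebra κ A] [Module.Finite κ A]

omit hp [IsLocalRing A] [CharP A p] [Module.Finite κ A] in
/-- A function `δ : A → A` which is additive, satisfies Leibniz' rule and kills `κ` is a `κ`-derivation (the
raw form in which the consumer `RelativePBasis.kimuraNiitsuma1982_theorem_of_harper` states its derivations).
[folklore] -/
private theorem exists_derivation_of_leibniz (δ : A → A) (hadd : ∀ b c, δ (b + c) = δ b + δ c)
    (hmul : ∀ b c, δ (b * c) = b * δ c + c * δ b) (hκ : ∀ c : κ, δ (algebraMap κ A c) = 0) :
    ∃ D : Derivation κ A A, ∀ a, D a = δ a := by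
  let L : A →ₗ[κ] A :=
    { toFun := δ
      map_add' := hadd
      map_smul' := fun c a => by
        rw [Algebra.smul_def, hmul, hκ, mul_zero, add_zero, RingHom.id_apply, Algebra.smul_def] }
  have h1 : δ 1 = 0 := by
    have h := hmul 1 1
    rw [one_mul, one_mul] at h
    simpa using h
  refine ⟨{ toLinearMap := L, map_one_eq_zero' := h1, leibniz' := fun b c => ?_ }, fun a => rfl⟩
  change δ (b * c) = b • δ c + c • δ b
  rw [smul_eq_mul, smul_eq_mul, hmul]

omit [CharP A p] in
/-- **Harper's theorem on differentiably simple rings (Harper 1961 Thm 1 for `κ = κ̄`; Yuan 1964; in the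
generality of del Buey–Sulca–Villamayor 2022 Thm 2.4 «Let `R` be a Noetherian differentiably simple ring of
characteristic `p`, `{x₁, …, xₙ}` a minimal generating set for the maximal ideal and `L ⊂ R` a coefficient field.
Then the `L`-algebra homomorphism `L[X₁, …, Xₙ] → R` given by `Xᵢ ↦ xᵢ` induces an isomorphism
`L[X₁, …, Xₙ]/⟨X₁^p, …, Xₙ^p⟩ ≅ R`»), presentation form.** Here for a local ring `A` of characteristic `p`,
module-finite over a coefficient field `κ` (every `a ∈ A` is `≡` a scalar mod `𝔫`), with `a^p = 0` on `𝔫`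
(redundant by Yuan's Lemma 2.2, kept as in the consumer's statement) and differentiably simple with respect to
`κ`-derivations given as raw additive Leibniz `κ`-killing maps: there are `x₁, …, xₙ` generating `𝔫` such that
`κ[X₁, …, Xₙ] → A`, `Xᵢ ↦ xᵢ`, is onto with kernel exactly `(X₁^p, …, Xₙ^p)`.
[cite: delBueySulcaVillamayor2022, Theorem 2.4] -/
theorem exists_presentation [CharP κ p]
    (hcoef : ∀ a : A, ∃ c : κ, a - algebraMap κ A c ∈ maximalIdeal A)
    (hp0 : ∀ a ∈ maximalIdeal A, a ^ p = 0)
    (hds : ∀ I : Ideal A, I ≠ ⊥ → I ≠ ⊤ → ∃ δ : A → A, (∀ b c, δ (b + c) = δ b + δ c) ∧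
        (∀ b c, δ (b * c) = b * δ c + c * δ b) ∧ (∀ c : κ, δ (algebraMap κ A c) = 0) ∧
        ∃ b ∈ I, δ b ∉ I) :
    ∃ (n : ℕ) (x : Fin n → A), Ideal.span (Set.range x) = maximalIdeal A ∧
      Function.Surjective (aeval x : MvPolynomial (Fin n) κ →ₐ[κ] A) ∧
      RingHom.ker (aeval x : MvPolynomial (Fin n) κ →ₐ[κ] A) = TruncPoly.frobIdeal κ p n := by
  haveI : IsNoetherianRing A := isNoetherian_of_tower κ (inferInstance : IsNoetherian κ A)
  obtain ⟨n, x, hx, hind⟩ := exists_generators_indep (A := A) (κ := κ)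
  have hxm : ∀ i, x i ∈ maximalIdeal A := fun i => hx ▸ Ideal.subset_span ⟨i, rfl⟩
  have hsurj := aeval_surjective x hcoef (exists_maximalIdeal_pow_eq_bot (κ := κ)) hx
  have hds' : ∀ I : Ideal A, I ≠ ⊥ → I ≠ ⊤ → ∃ δ : Derivation κ A A, ∃ b ∈ I, δ b ∉ I := by
    intro I h0 h1
    obtain ⟨δ, hadd, hmul, hκ, b, hb, hδb⟩ := hds I h0 h1
    obtain ⟨D, hD⟩ := exists_derivation_of_leibniz A κ δ hadd hmul hκ
    exact ⟨D, b, hb, by rw [hD]; exact hδb⟩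
  exact ⟨n, x, hx, hsurj, ker_aeval_eq_frobIdeal x hxm (fun i => hp0 _ (hxm i)) hsurj hind hds'⟩

/-- **Harper's theorem, in the consequence form `hH` used by Kimura–Niitsuma** (KN 1982 p. 375–376, via
S. Yuan's differential simplicity / Harper 1961 / Yuan 1964 Cor. 2.8; dBSV 2022 Thm 2.4): under the hypotheses of
`exists_presentation`, `𝔫` is generated by `e` elements with `p^e = dim_κ A` (namely `A ≅ κ[X₁, …, Xₑ]/(Xᵢ^p)`,
whose reduced monomials form a `κ`-basis, `TruncPoly.monBasis`). This is VERBATIM the binder `hH` of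
`RelativePBasis.kimuraNiitsuma1982_theorem_of_harper`. [cite: delBueySulcaVillamayor2022, Theorem 2.4] -/
theorem harper
    (hcoef : ∀ a : A, ∃ c : κ, a - algebraMap κ A c ∈ maximalIdeal A)
    (hp0 : ∀ a ∈ maximalIdeal A, a ^ p = 0)
    (hds : ∀ I : Ideal A, I ≠ ⊥ → I ≠ ⊤ → ∃ δ : A → A, (∀ b c, δ (b + c) = δ b + δ c) ∧
        (∀ b c, δ (b * c) = b * δ c + c * δ b) ∧ (∀ c : κ, δ (algebraMap κ A c) = 0) ∧
        ∃ b ∈ I, δ b ∉ I) :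
    ∃ (e : ℕ) (y : Fin e → A), Ideal.span (Set.range y) = maximalIdeal A ∧ p ^ e = Module.finrank κ A := by
  haveI : CharP κ p := (RingHom.charP_iff_charP (algebraMap κ A) p).mpr inferInstance
  obtain ⟨n, x, hx, hsurj, hker⟩ := exists_presentation p A κ hcoef hp0 hds
  refine ⟨n, x, hx, ?_⟩
  let Φ : TruncPoly.Alg κ p n ≃ₐ[κ] A :=
    (Ideal.quotientEquivAlgOfEq κ hker.symm).trans (Ideal.quotientKerAlgEquivOfSurjective hsurj)
  rw [← Φ.toLinearEquiv.finrank_eq, Module.finrank_eq_card_basis (TruncPoly.monBasis κ p n), Fintype.card_fun,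
    Fintype.card_fin, Fintype.card_fin]

end Harper

end HarperYuan

/-! ## Kunz's conjecture: the Kimura–Niitsuma theorem, discharged -/

/-- **DISCHARGE of the named fact F-96h `KimuraNiitsuma1982_theorem` (Kimura–Niitsuma 1982, THEOREM of §3;
Kunz's conjecture): a regular local ring `R` of characteristic `p > 0`, module-finite over a regular local subring
`R' ⊇ R^p`, has a `p`-basis over `R'`.** The tree's landed reductions `RelativePBasis.kimuraNiitsuma1982_theorem_of_lemma5`
(the printed induction, KN 1982 p. 377), `RelativePBasis.lemma5_of_harper` (their Lemma 5 from Harper's theorem through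
the Artinian core `R/𝔪^{[p]}R ⊇ R'/𝔪^{[p]}R'`, KN p. 375–376) and `RelativePBasis.kimuraNiitsuma1982_theorem_of_harper`,
fed with Harper's theorem `HarperYuan.harper` proved above.
[cite: KimuraNiitsuma1982, Theorem §3 p. 375] -/
theorem KimuraNiitsuma1982_theorem_holds : KimuraNiitsuma1982_theorem.{u} :=
  RelativePBasis.kimuraNiitsuma1982_theorem_of_harper.{u} fun p _ A _ _ _ κ _ _ _ hcoef hp0 hds =>
    HarperYuan.harper p A κ hcoef hp0 hds

end Literature.RingTheory.PBasis
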